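import Literature.Barriers.FinalStateConjecture.ExtremalHorizonTEnergy
import Literature.Barriers.FinalStateConjecture.ExtremalHorizonFiniteSpeed
import Literature.Geometry.Lorentzian.KerrStarMultiplierIdentity
import HarnessLib

/-!
# Barrier catalogue `FinalStateConjecture`: the `(f∂_r + h∂_{t*}, w)`-multiplier energy identity
# for Aretakis's class on the region `{r ≥ M} × [t₁, t₂]` outside the extremal Kerr horizon
# (`Literature/Barriers/FinalStateConjecture/`, D-0021, D-0014; family `gr`)

Written from the proving seat of `Literature.Barriers.FinalStateConjecture.Aretakis2012_pointwiseDecay`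
(Aretakis, JFA 263 (2012), Thm. 5), whose remaining input after
`ExtremalHorizonPointwiseDecayFromEnergy.lean` is the pair of energy estimates (Thms. 1–2 of the
source) proved in §§8–13 of the paper by the vector field method: for each of a handful of
multipliers `X = f ∂ + h T` with a Lagrangian correction `w`, the energy identity of the current
`J^{X,w}` on the region `𝓡(t₁, t₂) = {t₁ ≤ t* ≤ t₂} ∩ {r ≥ M}`, followed by sign arguments for the
bulk. **This file proves that identity for the class, for arbitrary smooth radial profiles
`f, h, w`, in the catalogue's vocabulary** (`Kerr.mult_identity_of_class`), assembling

* the coordinate identity `Kerr.StarCoord.mult_box_identity` (`KerrStarMultiplierIdentity.lean`)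
  for `G = Φ ∘ κ` on the box `[t₁, t₂] × [M, r₂] × [0, π]`, whose separated equation
  `𝓡G + 𝓐G = 0` off the axis is `Kerr.separated_equations_starPull`
  (`ExtremalHorizonCarterOperator.lean`);
* the vanishing of the outer flux through `{r = r₂}`, `r₂ > max(ρ, 2M) + 1 + T`, by finite speed
  of propagation for the class (`Kerr.fderiv_shellPoint_eq_zero_of_far`,
  `ExtremalHorizonFiniteSpeed.lean`);
* the horizon face `{r = M}`, where `Δ = (r − M)² = 0` leaves only tangential terms in the flux
  (`multFluxR_extremal_horizon`:
  `F(t, M, θ) = sin θ (½ f(M)((3M² + M²cos²θ)(∂_{t*}G)² − (∂_θG)²) + 2M² h(M)(∂_{t*}G)²)`).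

The result: for `0 ≤ t₁ ≤ t₂ ≤ T`,
`∫₀^π∫_M^{r₂} e(t₂) − ∫₀^π∫_M^{r₂} e(t₁) + ∫_{t₁}^{t₂}∫₀^π∫_M^{r₂} bulk = ∫_{t₁}^{t₂}∫₀^π F(t, M, θ) dθ dt`
with `e = multDensity M M f h w (Φ ∘ κ)`, `bulk = multBulk …` at the box points, translated to
derivatives of `Φ` at the shell points `p(t, r, θ, φ₀)` by the dictionary `pd_starPull_boxPoint`
(`∂₀G = TΦ`, `∂₁G = ∂_ρΦ = dΦ(0, n̂)`, `∂₂G = dΦ(0, rθ̂ + M cos θ φ̂)`). The `T`-energy case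
`f = w = 0`, `h = 1` is `Kerr.degTEnergy_antitone_and_horizonFlux_le` (`ExtremalHorizonTEnergy.lean`).
Everything is proved; no named facts (D-0026). What remains for Thms. 1–2 of the source is the
choice of the profiles (`§8`: `f = f^δ(r*)`-type currents for integrated decay away from `𝓗⁺`;
`§12–13`: the degenerate red-shift-type currents `(r − M)^{−k}`-weighted near `𝓗⁺`) and the
positivity/Hardy arguments for their bulks and boundary terms.

## References

* S. Aretakis, *Decay of axisymmetric solutions of the wave equation on extreme Kerr backgrounds*,
  J. Funct. Anal. 263 (2012) 2770–2831 (arXiv:1110.2006): §5.2 (the vector field method), §8 (the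
  currents), §§9–13 (key `Aretakis2012`).
* M. Dafermos, I. Rodnianski, arXiv:0811.0354, App. D (key `DafermosRodnianski2008`).
-/

noncomputable section

open Set Filter MeasureTheory intervalIntegral
open scoped Topology ContDiff Manifold

namespace Literature.Barriers.FinalStateConjecture.Kerr

open Literature.Geometry.Lorentzian
open Literature.Geometry.Lorentzian.Kerr.StarCoord

/-- **Dictionary**: the coordinate derivatives of `Φ ∘ κ` at a box point are the derivatives of `Φ`
at the shell point along the Kerr-star frame (`∂₀ ↦ ∂_{t*}`, `∂₁ ↦ (0, n̂)`, `∂₂ ↦ (0, rθ̂ + M cos θ φ̂)`).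
[cite: Aretakis2012, §2.4] -/
theorem pd_starPull_boxPoint {M : ℝ} {Φ : E4 → ℝ} {t r θ φ₀ : ℝ}
    (hΦ : DifferentiableAt ℝ Φ (shellPoint M t r θ φ₀)) (i : Fin 4) :
    pd i (Kerr.starPull M Φ) (boxPoint φ₀ t r θ) =
      fderiv ℝ Φ (shellPoint M t r θ φ₀) (Kerr.starFrame M (boxPoint φ₀ t r θ) i) := by
  have hΦ' : DifferentiableAt ℝ Φ (Kerr.starChart M (boxPoint φ₀ t r θ)) := by
    rw [starChart_boxPoint]; exact hΦ
  rw [pd_apply, Kerr.fderiv_starPull hΦ' i, starChart_boxPoint]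

/-- **The total radial flux on the extremal horizon** `r = M = a` (`Δ = 0`): only the tangential
terms survive,
`F(t, M, θ) = sin θ (½ f(M) ((3M² + M²cos²θ)(∂_{t*}G)² − (∂_θG)²) + 2M² h(M) (∂_{t*}G)²)`.
[cite: Aretakis2012, §8] -/
theorem multFluxR_extremal_horizon (M : ℝ) (f h w : ℝ → ℝ) (G : E4 → ℝ) {q : E4} (hq : q 1 = M) :
    multFluxR M M f h w G q = Real.sin (q 2) * (1 / 2 * f M * ((3 * M ^ 2 + M ^ 2 * Real.cos (q 2) ^ 2) *
      pd 0 G q ^ 2 - pd 2 G q ^ 2) + 2 * M ^ 2 * h M * pd 0 G q ^ 2) := by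
  simp only [multFluxR, radMultFluxR, timeMultFluxR, lagFluxR, tFluxR, hq]
  ring

section Identity

variable [Kerr.Facts] [Kerr.SliceFacts] {M r₀ : ℝ} {U₀ : Set (Kerr.region M r₀)} {Φ : E4 → ℝ}

/-- **The `(f∂_r + h∂_{t*}, w)`-multiplier energy identity for Aretakis's class outside the extremal
horizon.** Let `Φ` be `C^∞` at the points of an open `U₀ ⊇ {r ≥ M, t* ≥ 0}` of the extremal
Kerr–Schild chart, axisymmetric on `{r > 0}`, with `□_{g_{M,M}}Φ = 0` on `U₀` and data vanishing on
`{t* = 0, ‖x⃗‖ > ρ}`; let `f, h, w` be smooth radial profiles, `0 ≤ t₁ ≤ t₂ ≤ T` and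
`r₂ > max(ρ, 2M) + 1 + T` (beyond the support of the wave, `Kerr.fderiv_shellPoint_eq_zero_of_far`).
Then, with `G = Φ ∘ κ` and the densities of `KerrStarMultiplierIdentity.lean` evaluated at the box
points `(t, r, θ, φ₀)` (dictionary `pd_starPull_boxPoint`):
`∫₀^π∫_M^{r₂} e(t₂) − ∫₀^π∫_M^{r₂} e(t₁) + ∫_{t₁}^{t₂}∫₀^π∫_M^{r₂} bulk = ∫_{t₁}^{t₂}∫₀^π F(t, M, θ) dθ dt`,
`e = multDensity`, `bulk = multBulk`, and `F(t, M, θ)` the horizon flux of `multFluxR_extremal_horizon`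
— the energy identity of the current `J^{X,w}`, `X = f∂_r + h∂_{t*}`, on the region
`𝓡(t₁, t₂) = {t₁ ≤ t* ≤ t₂} ∩ {r ≥ M}` of Aretakis 2012, §§8–13, with the horizon `{r = M}` as the
inner face and no contribution from large `r`. [cite: Aretakis2012, §8] -/
theorem mult_identity_of_class (hM : 0 < M) (hr₀ : r₀ ∈ Set.Ioo 0 M) (hU₀ : IsOpen U₀)
    (hKU : {x : Kerr.region M r₀ | Kerr.rPlus M M ≤ Kerr.radius M (x : E4) ∧ 0 ≤ (x : E4) 0} ⊆ U₀)
    (hΦ : ∀ x ∈ U₀, ContDiffAt ℝ ∞ Φ x)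
    (haxi : ∀ (β : ℝ) (z : E4), 0 < Kerr.radius M z → Φ (E4.axialRotation β z) = Φ z)
    (hsol : ∀ x ∈ U₀, (Kerr.smoothMetric M M r₀).toPseudoRiemannianMetric.dalembertian
      (fun y : Kerr.region M r₀ ↦ Φ y) x = 0)
    {ρ : ℝ} (hloc : ∀ x ∈ U₀, (x : E4) 0 = 0 → ρ < E4.spatialNorm (x : E4) → Φ x = 0 ∧ fderiv ℝ Φ x = 0)
    {f h w : ℝ → ℝ} (hf : ContDiff ℝ ∞ f) (hh : ContDiff ℝ ∞ h) (hw : ContDiff ℝ ∞ w)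
    {t₁ t₂ T r₂ φ₀ : ℝ} (ht₁ : 0 ≤ t₁) (ht : t₁ ≤ t₂) (hT : t₂ ≤ T) (hr₂ : max ρ (2 * M) + 1 + T < r₂) :
    (∫ θ in (0 : ℝ)..Real.pi, ∫ r in M..r₂, multDensity M M f h w (Kerr.starPull M Φ) (boxPoint φ₀ t₂ r θ)) -
        (∫ θ in (0 : ℝ)..Real.pi, ∫ r in M..r₂, multDensity M M f h w (Kerr.starPull M Φ) (boxPoint φ₀ t₁ r θ)) +
        (∫ t in t₁..t₂, ∫ θ in (0 : ℝ)..Real.pi, ∫ r in M..r₂,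
          multBulk M M f h w (Kerr.starPull M Φ) (boxPoint φ₀ t r θ)) =
      ∫ t in t₁..t₂, ∫ θ in (0 : ℝ)..Real.pi,
        multFluxR M M f h w (Kerr.starPull M Φ) (boxPoint φ₀ t M θ) := by
  obtain ⟨hr₀pos, hr₀M⟩ := hr₀
  have hπ := Real.pi_pos
  have hMr₂ : M ≤ r₂ := by
    have : 2 * M ≤ max ρ (2 * M) := le_max_right _ _
    linarith [ht₁, ht, hT]
  -- the coordinate open set and the separated equation off the axis
  set V : Set E4 := Subtype.val '' U₀ with hVdef
  have hV : IsOpen V := (Kerr.region M r₀).isOpen.isOpenMap_subtype_val U₀ hU₀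
  have hΦV : ∀ z ∈ V, ContDiffAt ℝ ∞ Φ z := by
    rintro _ ⟨y, hyU, rfl⟩; exact hΦ y hyU
  set W₀ : Set E4 := {q : E4 | 0 < q 1 ∧ Kerr.starChart M q ∈ V} with hW₀def
  have hW₀ : IsOpen W₀ := (isOpen_lt continuous_const (PiLp.continuous_apply 2 _ 1)).inter
    (hV.preimage (Kerr.contDiff_starChart M (n := 0)).continuous)
  set G : E4 → ℝ := Kerr.starPull M Φ with hGdef
  have hG : ContDiffOn ℝ ∞ G W₀ := fun q hq ↦
    (Kerr.contDiffAt_comp_starChart (hΦV _ hq.2)).contDiffWithinAt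
  obtain ⟨-, -, -, hsep, -⟩ := separated_equations_starPull hU₀ hΦ haxi hsol
  have hP : ∀ q ∈ W₀, Real.sin (q 2) ≠ 0 → radOp M M G q + angOp M G q = 0 :=
    fun q hq hs ↦ hsep q ⟨hq.1, hs, hq.2⟩
  -- the box lies in `W₀`
  have hK'reg : ∀ x : E4, Kerr.rPlus M M ≤ Kerr.radius M x ∧ 0 ≤ x 0 → x ∈ Kerr.region M r₀ := by
    intro x hx
    rw [Kerr.mem_region]
    have h1 := hx.1
    rw [Kerr.rPlus_self] at h1
    exact max_lt (by linarith) (by linarith)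
  have hbox : ∀ t ∈ Icc t₁ t₂, ∀ r ∈ Icc M r₂, ∀ θ ∈ Icc 0 Real.pi, boxPoint φ₀ t r θ ∈ W₀ := by
    intro t ht' r hr' θ _
    have hK := shellPoint_mem_horizonFutureSet hM (ht₁.trans ht'.1) hr'.1 θ φ₀
    refine ⟨hM.trans_le hr'.1, ?_⟩
    rw [starChart_boxPoint]
    exact ⟨⟨_, hK'reg _ hK⟩, hKU hK, rfl⟩
  -- the box identity
  have hid := mult_box_identity (M := M) (a := M) hW₀ hG hP hf hh hw ht hMr₂ hbox
  -- the outer flux vanishes: `Φ`, `dΦ` vanish at the shell points `p(t, r₂, θ, φ₀)`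
  have hfar : ∀ t ∈ Icc t₁ t₂, ∀ θ : ℝ, multFluxR M M f h w G (boxPoint φ₀ t r₂ θ) = 0 := by
    intro t ht' θ
    obtain ⟨hΦ0, hdΦ0⟩ := fderiv_shellPoint_eq_zero_of_far hM ⟨hr₀pos, hr₀M⟩ hU₀ hKU hΦ hsol hloc hr₂
      (ht₁.trans ht'.1) (ht'.2.trans hT) θ φ₀
    have hK := shellPoint_mem_horizonFutureSet hM (ht₁.trans ht'.1) hMr₂ θ φ₀
    have hq : boxPoint φ₀ t r₂ θ ∈ W₀ := by
      refine ⟨hM.trans_le hMr₂, ?_⟩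
      rw [starChart_boxPoint]
      exact ⟨⟨_, hK'reg _ hK⟩, hKU hK, rfl⟩
    have hd : DifferentiableAt ℝ Φ (shellPoint M t r₂ θ φ₀) := by
      rw [← starChart_boxPoint]; exact (hΦV _ hq.2).differentiableAt (by simp)
    have hG0 : G (boxPoint φ₀ t r₂ θ) = 0 := by
      rw [hGdef, Kerr.starPull_apply, starChart_boxPoint]; exact hΦ0
    have hpd : ∀ i, pd i G (boxPoint φ₀ t r₂ θ) = 0 := fun i ↦ by
      rw [hGdef, pd_starPull_boxPoint hd, hdΦ0]; rfl
    simp only [multFluxR, radMultFluxR, timeMultFluxR, lagFluxR, tFluxR, hG0, hpd, mul_zero,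
      add_zero, zero_pow two_ne_zero, sub_self]
  have hfar' : (∫ t in t₁..t₂, ∫ θ in (0 : ℝ)..Real.pi,
      (multFluxR M M f h w G (boxPoint φ₀ t r₂ θ) - multFluxR M M f h w G (boxPoint φ₀ t M θ))) =
      -∫ t in t₁..t₂, ∫ θ in (0 : ℝ)..Real.pi, multFluxR M M f h w G (boxPoint φ₀ t M θ) := by
    rw [← intervalIntegral.integral_neg]
    refine intervalIntegral.integral_congr fun t ht' ↦ ?_
    rw [uIcc_of_le ht] at ht'
    rw [← intervalIntegral.integral_neg]
    refine intervalIntegral.integral_congr fun θ _ ↦ ?_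
    rw [hfar t ht' θ, zero_sub]
  rw [hfar'] at hid
  linarith

end Identity

end Literature.Barriers.FinalStateConjecture.Kerr

end
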